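import Literature.GroupTheory.CombinatorialGroupTheory.FreeGroupConjugacySeparable
import Mathlib.GroupTheory.OrderOfElement
import HarnessLib

/-!
# Free groups are cyclic conjugacy separable, I: pinning the exponent by abelian quotients

Topic `Literature/GroupTheory/CombinatorialGroupTheory`; theorems only.  First half of the proof that
free groups are *cyclic conjugacy separable* (J. L. Dyer, J. Austral. Math. Soc. (A) 29 (1980),
Lemma 8 with Lemma 6; C. Y. Tang, J. Pure Appl. Algebra 1997, Def. 2.3): *if `x ∈ F(ι)` is conjugate
to no power of `h`, some finite quotient of `F(ι)` keeps the image of `x` conjugate to no power of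
the image of `h`* (the assembly is `FreeGroupCyclicConjugacySeparable.lean`).  This file treats the
cases in which an EXPONENT SUM is non-zero; write `σⱼ : F → ℤ` for the exponent sum in the letter `j`:

* `sep_of_expSum_h_ne_one` — **some `σⱼ₀(h) = b ≠ 0`**: the exponent `n` of a would-be conjugate
  `hⁿ` is PINNED by abelian quotients — if `b ∤ σⱼ₀(x)`, the quotient `σⱼ₀ mod |b|` separates `x`
  from all of `⟨h⟩`; if `σⱼ₀(x) = n₀ b` but `d = σⱼ(x) − n₀ σⱼ(h) ≠ 0` for some `j`, the quotient
  `(σⱼ₀ mod 2|b||d|, σⱼ mod 2|d|)` does; and if `σⱼ(x) = n₀ σⱼ(h)` for all `j`, the tree's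
  conjugacy separability of free groups (`FreeGroup.exists_normal_finiteIndex_not_isConj`,
  Lyndon–Schupp I.4.8) separates `x` from the single power `h^{n₀}` in some `F ⧸ K₁`, while
  `σⱼ₀ mod |b|·N₁` (`N₁` the order of `h̄` in `F ⧸ K₁`) forces `n ≡ n₀ (mod N₁)`, i.e. `h̄ⁿ = h̄^{n₀}`;
* `sep_of_expSum_h_trivial` — **all `σⱼ(h) = 0`, some `σⱼ(x) ≠ 0`**: `σⱼ mod (|σⱼ(x)|+1)` works;
* bookkeeping: `isConj_mk_of_le`, `apply_eq_of_isConj_mk_ker`, `dvd_of_natAbs_mul_dvd_mul`.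

The remaining case (all exponent sums of `x` and `h` vanish) is the index-two descent of part II.

## References

* J. L. Dyer, *Separating conjugates in amalgamated free products and HNN extensions*, J. Austral.
  Math. Soc. Ser. A 29 (1980) 35–51, Lemma 8 (with Lemma 6), Thm. 10. [Dyer1980]
* C. Y. Tang, *Conjugacy separability of generalized free products of surface groups*, J. Pure
  Appl. Algebra 120 (1997) 187–194, Def. 2.3, Lemma 2.4. [Tang1997]
* R. C. Lyndon, P. E. Schupp, *Combinatorial Group Theory*, Springer (1977); Classics in
  Mathematics (2001), Ch. I Prop. 4.8. [LyndonSchupp2001]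
-/

namespace Literature.GroupTheory.CombinatorialGroupTheory

universe u

namespace FreeGroupCyclicConjugacySeparable

/-! ### Generic bookkeeping on quotients -/

/-- Passing to a smaller normal subgroup reflects conjugacy of images (the bookkeeping step
"`K₀ ∩ K₁` … normal core" of Lyndon–Schupp's proof). [cite: LyndonSchupp2001, Ch. I Prop. 4.8 proof] -/
theorem isConj_mk_of_le {G : Type u} [Group G] {K K' : Subgroup G} [K.Normal] [K'.Normal]
    (hle : K' ≤ K) {a b : G} (h : IsConj (QuotientGroup.mk a : G ⧸ K') (QuotientGroup.mk b)) :
    IsConj (QuotientGroup.mk a : G ⧸ K) (QuotientGroup.mk b) := by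
  have := MonoidHom.map_isConj (QuotientGroup.map K' K (MonoidHom.id G) hle) h
  simpa only [QuotientGroup.map_mk, MonoidHom.id_apply] using this

/-- In the quotient by the kernel of a homomorphism to a COMMUTATIVE group, conjugate images have
equal values (*"the images … in this abelian group are then distinct and therefore not conjugate"*).
[cite: LyndonSchupp2001, Ch. I Prop. 4.8 proof] -/
theorem apply_eq_of_isConj_mk_ker {G : Type u} [Group G] {A : Type*} [CommGroup A] (φ : G →* A)
    {a b : G} (h : IsConj (QuotientGroup.mk a : G ⧸ φ.ker) (QuotientGroup.mk b)) : φ a = φ b := by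
  have hc : IsConj (φ a) (φ b) := by
    have := MonoidHom.map_isConj (QuotientGroup.kerLift φ) h
    rwa [QuotientGroup.kerLift_mk, QuotientGroup.kerLift_mk] at this
  exact isConj_iff_eq.mp hc

/-- Cancelling `|b|` from a divisibility `|b|·M ∣ k·b` (`b ≠ 0`). [folklore] -/
private theorem dvd_of_natAbs_mul_dvd_mul {b k : ℤ} {M : ℕ} (hb : b ≠ 0)
    (h : ((b.natAbs * M : ℕ) : ℤ) ∣ k * b) : (M : ℤ) ∣ k := by
  have h1 : b.natAbs * M ∣ (k * b).natAbs := Int.ofNat_dvd_left.mp h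
  rw [Int.natAbs_mul, mul_comm k.natAbs] at h1
  have h2 : M ∣ k.natAbs :=
    Nat.dvd_of_mul_dvd_mul_left (Int.natAbs_pos.mpr hb) h1
  exact Int.ofNat_dvd_left.mpr h2

section ExpSums

variable {ι : Type u} [DecidableEq ι]

-- the exponent sum `σⱼ : F →* ℤ` (multiplicative notation), as in `FreeGroupExponentSums`
set_option quotPrecheck false in
local notation3 "σ" => fun (j : ι) => (FreeGroup.lift fun i : ι =>
  (if i = j then Multiplicative.ofAdd (1 : ℤ) else (1 : Multiplicative ℤ)) :
    FreeGroup ι →* Multiplicative ℤ)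

-- reduction of `σⱼ` modulo `m`
set_option quotPrecheck false in
local notation3 "σmod" => fun (j : ι) (m : ℕ) =>
  ((AddMonoidHom.toMultiplicative (Int.castAddHom (ZMod m))).comp (σ j) :
    FreeGroup ι →* Multiplicative (ZMod m))

/-- Exponent sums of powers: `σⱼ(gⁿ) = n · σⱼ(g)`. [folklore] -/
private theorem toAdd_expSum_zpow (j : ι) (g : FreeGroup ι) (n : ℤ) :
    Multiplicative.toAdd (σ j (g ^ n)) = n * Multiplicative.toAdd (σ j g) := by
  rw [map_zpow, toAdd_zpow, smul_eq_mul]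

/-- The kernel of `σⱼ mod m` (`m ≥ 1`) has finite index. [folklore] -/
private theorem finiteIndex_ker_expSumMod (j : ι) (m : ℕ) [NeZero m] : (σmod j m).ker.FiniteIndex := by
  haveI : Finite (σmod j m).range := inferInstance
  exact Subgroup.finiteIndex_ker _

/-- **Abelian separation.** If `x̄ ~ ȳ` in `F ⧸ K` with `K` contained in the kernel of `σⱼ mod m`, then
`m ∣ σⱼ(x) − σⱼ(y)`. [cite: LyndonSchupp2001, Ch. I Prop. 4.8 proof] -/
private theorem dvd_sub_of_isConj_mk (j : ι) (m : ℕ) {K : Subgroup (FreeGroup ι)} [K.Normal]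
    (hK : K ≤ (σmod j m).ker) {x y : FreeGroup ι}
    (h : IsConj (QuotientGroup.mk x : FreeGroup ι ⧸ K) (QuotientGroup.mk y)) :
    (m : ℤ) ∣ Multiplicative.toAdd (σ j x) - Multiplicative.toAdd (σ j y) := by
  have h1 := apply_eq_of_isConj_mk_ker (σmod j m) (isConj_mk_of_le hK h)
  have h2 : ((Multiplicative.toAdd (σ j x) : ℤ) : ZMod m) =
      ((Multiplicative.toAdd (σ j y) : ℤ) : ZMod m) := congrArg Multiplicative.toAdd h1
  exact (ZMod.intCast_eq_intCast_iff_dvd_sub _ _ _).mp h2.symm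

/-- **Case (B)**: all exponent sums of `h` vanish and some `σⱼ(x) ≠ 0` — then `σⱼ mod (|σⱼ(x)|+1)`
separates `x` from every power of `h`. [cite: Dyer1980, Lemma 8 p.47] -/
theorem sep_of_expSum_h_trivial {x h : FreeGroup ι} (j : ι) (hh : σ j h = 1) (hxj : σ j x ≠ 1) :
    ∃ (K : Subgroup (FreeGroup ι)) (_ : K.Normal), K.FiniteIndex ∧
      ∀ n : ℤ, ¬ IsConj (QuotientGroup.mk x : FreeGroup ι ⧸ K) (QuotientGroup.mk (h ^ n)) := by
  set a : ℤ := Multiplicative.toAdd (σ j x) with ha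
  have ha0 : a ≠ 0 := fun h0 => hxj (by
    have : Multiplicative.toAdd (σ j x) = Multiplicative.toAdd (1 : Multiplicative ℤ) := by
      rw [← ha, h0]; rfl
    exact Multiplicative.toAdd.injective this)
  set m : ℕ := a.natAbs + 1 with hm
  haveI : NeZero m := ⟨Nat.succ_ne_zero _⟩
  refine ⟨(σmod j m).ker, inferInstance, finiteIndex_ker_expSumMod j m, fun n hc => ?_⟩
  have hd := dvd_sub_of_isConj_mk j m le_rfl hc
  rw [toAdd_expSum_zpow, hh, ← ha] at hd
  have h0 : Multiplicative.toAdd (1 : Multiplicative ℤ) = 0 := rfl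
  rw [h0, mul_zero, sub_zero] at hd
  have h1 := Int.le_of_dvd (by positivity) ((Int.dvd_natAbs).mpr hd)
  push_cast [hm] at h1
  omega

/-- **Case (A)**: some `σⱼ₀(h) ≠ 0` — the exponent is pinned by abelian quotients, and the tree's
conjugacy separability of free groups handles the one remaining power.
[cite: Dyer1980, Lemma 8 p.47] -/
theorem sep_of_expSum_h_ne_one {x h : FreeGroup ι} (j₀ : ι) (hb : σ j₀ h ≠ 1)
    (hxh : ∀ n : ℤ, ¬ IsConj x (h ^ n)) :
    ∃ (K : Subgroup (FreeGroup ι)) (_ : K.Normal), K.FiniteIndex ∧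
      ∀ n : ℤ, ¬ IsConj (QuotientGroup.mk x : FreeGroup ι ⧸ K) (QuotientGroup.mk (h ^ n)) := by
  set a : ℤ := Multiplicative.toAdd (σ j₀ x) with ha
  set b : ℤ := Multiplicative.toAdd (σ j₀ h) with hb'
  have hb0 : b ≠ 0 := fun h0 => hb (by
    have : Multiplicative.toAdd (σ j₀ h) = Multiplicative.toAdd (1 : Multiplicative ℤ) := by
      rw [← hb', h0]; rfl
    exact Multiplicative.toAdd.injective this)
  have hbpos : 0 < b.natAbs := Int.natAbs_pos.mpr hb0
  by_cases hdiv : b ∣ a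
  · obtain ⟨n₀, hn₀⟩ := hdiv
    -- `a = b * n₀`
    by_cases hall : ∀ j : ι, Multiplicative.toAdd (σ j x) = n₀ * Multiplicative.toAdd (σ j h)
    · -- (A3) all exponent sums pinned to `n₀`: free c.s. for the pair `(x, h ^ n₀)` + `σⱼ₀ mod |b| N₁`
      obtain ⟨K₁, hK₁n, hK₁f, hK₁⟩ := FreeGroup.exists_normal_finiteIndex_not_isConj (hxh n₀)
      haveI := hK₁n
      haveI := hK₁f
      haveI : Finite (FreeGroup ι ⧸ K₁) := Subgroup.finite_quotient_of_finiteIndex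
      set N₁ : ℕ := orderOf (QuotientGroup.mk h : FreeGroup ι ⧸ K₁) with hN₁
      have hN₁pos : 0 < N₁ := orderOf_pos _
      set m : ℕ := b.natAbs * N₁ with hm
      haveI : NeZero m := ⟨Nat.mul_ne_zero hbpos.ne' hN₁pos.ne'⟩
      haveI := finiteIndex_ker_expSumMod j₀ m
      haveI : (K₁ ⊓ (σmod j₀ m).ker).FiniteIndex := inferInstance
      refine ⟨K₁ ⊓ (σmod j₀ m).ker, inferInstance, inferInstance, fun n hc => ?_⟩
      -- abelian part: `m ∣ a − n b = (n₀ − n) b`, hence `N₁ ∣ n₀ − n`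
      have hd := dvd_sub_of_isConj_mk j₀ m (inf_le_right : K₁ ⊓ (σmod j₀ m).ker ≤ _) hc
      rw [toAdd_expSum_zpow, ← ha, ← hb', hn₀] at hd
      have hd' : ((b.natAbs * N₁ : ℕ) : ℤ) ∣ (n₀ - n) * b := by
        have : b * n₀ - n * b = (n₀ - n) * b := by ring
        rwa [this] at hd
      have hN : (N₁ : ℤ) ∣ n₀ - n := dvd_of_natAbs_mul_dvd_mul hb0 hd'
      -- hence `h̄ⁿ = h̄^{n₀}` in `F ⧸ K₁`
      have hpow : (QuotientGroup.mk (h ^ n) : FreeGroup ι ⧸ K₁) = QuotientGroup.mk (h ^ n₀) := by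
        rw [QuotientGroup.mk_zpow, QuotientGroup.mk_zpow]
        have h1 : (QuotientGroup.mk h : FreeGroup ι ⧸ K₁) ^ (n₀ - n) = 1 := by
          rw [← orderOf_dvd_iff_zpow_eq_one]; exact hN
        calc (QuotientGroup.mk h : FreeGroup ι ⧸ K₁) ^ n
            = (QuotientGroup.mk h) ^ n * (QuotientGroup.mk h) ^ (n₀ - n) := by rw [h1, mul_one]
          _ = (QuotientGroup.mk h) ^ n₀ := by rw [← zpow_add]; congr 1; ring
      -- non-abelian part: contradiction with `K₁`
      apply hK₁
      have := isConj_mk_of_le (inf_le_left : K₁ ⊓ (σmod j₀ m).ker ≤ K₁) hc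
      rwa [hpow] at this
    · -- (A2) some `σⱼ(x) ≠ n₀ σⱼ(h)`: two abelian quotients
      push Not at hall
      obtain ⟨j, hj⟩ := hall
      set d : ℤ := Multiplicative.toAdd (σ j x) - n₀ * Multiplicative.toAdd (σ j h) with hd
      have hd0 : d ≠ 0 := fun h0 => by
        have : Multiplicative.toAdd (σ j x) - n₀ * Multiplicative.toAdd (σ j h) = 0 := by
          rw [← hd]; exact h0
        exact hj (sub_eq_zero.mp this)
      set M : ℕ := 2 * d.natAbs with hM
      have hMpos : 0 < M := by have := Int.natAbs_pos.mpr hd0; omega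
      haveI : NeZero M := ⟨hMpos.ne'⟩
      set m : ℕ := b.natAbs * M with hm
      haveI : NeZero m := ⟨Nat.mul_ne_zero hbpos.ne' hMpos.ne'⟩
      haveI := finiteIndex_ker_expSumMod j₀ m
      haveI := finiteIndex_ker_expSumMod j M
      haveI : ((σmod j₀ m).ker ⊓ (σmod j M).ker).FiniteIndex := inferInstance
      refine ⟨(σmod j₀ m).ker ⊓ (σmod j M).ker, inferInstance, inferInstance, fun n hc => ?_⟩
      -- first coordinate: `M ∣ n₀ − n`
      have h1 := dvd_sub_of_isConj_mk j₀ m (inf_le_left : (σmod j₀ m).ker ⊓ (σmod j M).ker ≤ _) hc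
      rw [toAdd_expSum_zpow, ← ha, ← hb', hn₀] at h1
      have h1' : ((b.natAbs * M : ℕ) : ℤ) ∣ (n₀ - n) * b := by
        have : b * n₀ - n * b = (n₀ - n) * b := by ring
        rwa [this] at h1
      have hMn : (M : ℤ) ∣ n₀ - n := dvd_of_natAbs_mul_dvd_mul hb0 h1'
      -- second coordinate: `M ∣ σⱼ(x) − n σⱼ(h) = d + (n₀ − n) σⱼ(h)`, hence `M ∣ d`: absurd
      have h2 := dvd_sub_of_isConj_mk j M (inf_le_right : (σmod j₀ m).ker ⊓ (σmod j M).ker ≤ _) hc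
      rw [toAdd_expSum_zpow] at h2
      have h3 : (M : ℤ) ∣ d := by
        have : d = (Multiplicative.toAdd (σ j x) - n * Multiplicative.toAdd (σ j h)) -
            (n₀ - n) * Multiplicative.toAdd (σ j h) := by rw [hd]; ring
        rw [this]
        exact dvd_sub h2 (dvd_mul_of_dvd_left hMn _)
      have h4 : d = 0 := Int.eq_zero_of_dvd_of_natAbs_lt_natAbs h3 (by
        rw [Int.natAbs_natCast, hM]; omega)
      exact hd0 h4
  · -- (A1) `b ∤ a`: the quotient `σⱼ₀ mod |b|`
    haveI : NeZero b.natAbs := ⟨hbpos.ne'⟩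
    refine ⟨(σmod j₀ b.natAbs).ker, inferInstance, finiteIndex_ker_expSumMod j₀ b.natAbs,
      fun n hc => ?_⟩
    have h1 := dvd_sub_of_isConj_mk j₀ b.natAbs le_rfl hc
    rw [toAdd_expSum_zpow, ← ha, ← hb', Int.natAbs_dvd] at h1
    -- `b ∣ a − n b` gives `b ∣ a`
    exact hdiv ((dvd_sub_left (dvd_mul_left b n)).mp h1)

end ExpSums

end FreeGroupCyclicConjugacySeparable

end Literature.GroupTheory.CombinatorialGroupTheory
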